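import Summits.RiemannHypothesis.RiemannHypothesis.Theses.SpectralTrace
import Summits.RiemannHypothesis.RiemannHypothesis.Theorems.SpectralTraceSpectralThesisStubKernelToolkit
import Summits.RiemannHypothesis.RiemannHypothesis.Theorems.SpectralTraceSpectralThesisStubDensity
import Summits.RiemannHypothesis.RiemannHypothesis.Theorems.SpectralTraceSpectralThesisStubSumByParts
import Summits.RiemannHypothesis.RiemannHypothesis.Theorems.SpectralTraceSpectralThesisStubSawtoothSmoothing
import Summits.RiemannHypothesis.RiemannHypothesis.Theorems.SpectralTraceSpectralThesisStubFixedPoint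
import Summits.RiemannHypothesis.RiemannHypothesis.Theorems.SpectralTraceSpectralThesisStubVerify
import Summits.RiemannHypothesis.RiemannHypothesis.Theorems.SpectralTraceSpectralThesisOpenLadderCalibration
import HarnessLib

/-!
# Crux `SpectralThesis` (stmt-RiemannHypothesis-0187), line `Sketch` — the BASE RUNG, unconditionally

`stub_baseRung : ∃ A₀ > 0, ∃ ι (γ : ι → ℝ), ∀ g, IsWeilTest g → tsupport g ⊆ Ioo (-A₀) A₀ →
  HasSum (n ↦ ĝ(1/2 + iγ_n)) (W g)` — a real unit-atomic spectrum reproducing the Weil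
distribution on a (tiny) open window, with no hypothesis. This is the glue of the exact
warped-lattice quadrature: with `q_A` the Fourier kernel of the plateau `χ(x/A)` and `ν_A` the
smoothed archimedean density of `stub_density` (`∫ ĝ ν_A = W(g)` on `[-A, A]`,
`ν_A ≥ log(1/A)/2π − C₁`), the points are `γ_n = Φ⁻¹(n)`, `Φ = M_A + q_A ∗ f`, `M_A' = ν_A`,
`f` the Banach fixed point of `T f = q_A ∗ fract(M_A + q_A ∗ f)` (`stub_fixedPoint`, contraction by
`stub_sawtoothSmoothing` once `A` is small); `stub_sumByParts` gives
`Σ ĝ(γ_n) = ∫ ĝ Φ' + ∫ ĝ' fract Φ` and `stub_verify` the exact cancellation down to `W(g)`.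
Consequence for the line: by the landed calibration (p92634) the crux `SpectralThesis` is now
EXACTLY the openness stub `OpenLadder` (`↔ RH`).
-/

noncomputable section

set_option linter.dupNamespace false

open Complex Set MeasureTheory Filter
open scoped Real Topology ContDiff

namespace Summit.RiemannHypothesis.RiemannHypothesis.Theorems.SpectralThesis.Sketch

open Literature.NumberTheory.LFunctions
open Summit.RiemannHypothesis.RiemannHypothesis.Theses.SpectralTrace

/-! ### Glue lemmas -/

namespace BaseRungGlue

/-- Dilation bookkeeping: for `0 < A ≤ 1`, `k ≥ 1`, `Aᵏ · C/(1+(At)²) ≤ (C/A)/(1+t²)`. [folklore] -/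
theorem dilate_bound {A C : ℝ} (hA : 0 < A) (hA1 : A ≤ 1) (hC : 0 ≤ C) (k : ℕ) (hk : 1 ≤ k)
    (t : ℝ) : A ^ k * (C / (1 + (A * t) ^ 2)) ≤ C / A / (1 + t ^ 2) := by
  have hAk : A ^ k ≤ A := by
    calc A ^ k ≤ A ^ 1 := pow_le_pow_of_le_one hA.le hA1 hk
      _ = A := pow_one A
  have h1 : 0 < 1 + (A * t) ^ 2 := by positivity
  have h2 : 0 < 1 + t ^ 2 := by positivity
  -- A^k C/(1+(At)²) ≤ A C/(1+(At)²) ≤ (C/A)/(1+t²)  iff  A² (1+t²) ≤ 1 + A² t²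
  have step1 : A ^ k * (C / (1 + (A * t) ^ 2)) ≤ A * (C / (1 + (A * t) ^ 2)) :=
    mul_le_mul_of_nonneg_right hAk (by positivity)
  refine step1.trans ?_
  rw [mul_div_assoc', div_le_div_iff₀ h1 h2, div_mul_eq_mul_div, le_div_iff₀ hA]
  have hA2 : A ^ 2 ≤ 1 := by nlinarith
  nlinarith [mul_nonneg hC (sq_nonneg t), mul_nonneg (mul_nonneg hC (sq_nonneg t)) (sub_nonneg.2 hA2),
    mul_nonneg hC (sub_nonneg.2 hA2)]

end BaseRungGlue

/-- **`stub_baseRung` — the BASE RUNG of the window ladder, unconditionally**: some positive open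
window `(-A₀, A₀)` carries a real unit-atomic family `γ : ℤ → ℝ` with
`Σ_n ĝ(1/2 + iγ_n) = W(g)` for every Weil test `g` supported in it. Glue of the six landed stubs
(`stub_kernelToolkit`, `stub_density`, `stub_sumByParts`, `stub_sawtoothSmoothing`,
`stub_fixedPoint`, `stub_verify`): plateau from a `ContDiffBump`, dilation, choice of `A` against
the toolkit/density constants, primitive of `ν_A`, Banach fixed point, phase inversion, assembly
on `ι = ℤ` (the family is `n ↦ Φ⁻¹(n)`, `Φ = ∫₀ ν_A + q_A ∗ f`). [folklore] -/
theorem stub_baseRung :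
    ∃ A₀ : ℝ, 0 < A₀ ∧ ∃ (ι : Type) (γ : ι → ℝ), ∀ g : ℝ → ℂ, IsWeilTest g →
      tsupport g ⊆ Set.Ioo (-A₀) A₀ →
        HasSum (fun i => weilMellin g (1 / 2 + (γ i : ℂ) * I)) (weilFunctional g) := by
  classical
  obtain ⟨hK, hT⟩ := stub_kernelToolkit
  /- plateau `χ = 1` on `[-1,1]`, supported in `[-2,2]`, even, smooth -/
  let b : ContDiffBump (0 : ℝ) := ⟨1, 2, one_pos, one_lt_two⟩
  set χ : ℝ → ℝ := fun x => b x with hχdef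
  have hχ_smooth : ContDiff ℝ ∞ χ := b.contDiff
  have hχ_cpt : HasCompactSupport χ := b.hasCompactSupport
  have hχ_even : ∀ x, χ (-x) = χ x := fun x => b.neg x
  have hχ_one : ∀ x : ℝ, |x| ≤ 1 → χ x = 1 := fun x hx =>
    b.one_of_mem_closedBall (by simpa [Metric.mem_closedBall, Real.dist_eq] using hx)
  obtain ⟨K, dK, ddK, CK, hKdef, hKd, hdKd, hddKc, hKeven, hKb, hdKb, hddKb, hKinv, hKdil, hKrep⟩ :=
    hK χ hχ_smooth hχ_cpt hχ_even
  have hCK : 0 ≤ CK := by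
    have h := hKb 0
    have : (0 : ℝ) ≤ CK / (1 + 0 ^ 2) := (abs_nonneg _).trans h
    simpa using this
  have hK_cont : Continuous K := continuous_iff_continuousAt.2 fun t => (hKd t).continuousAt
  have hdK_cont : Continuous dK := continuous_iff_continuousAt.2 fun t => (hdKd t).continuousAt
  have hKi : Integrable K := FixedPoint.integrable_of_decay hK_cont hKb
  have hdKi : Integrable dK := FixedPoint.integrable_of_decay hdK_cont hdKb
  have hddKi : Integrable ddK := FixedPoint.integrable_of_decay hddKc hddKb
  /- density constants -/
  obtain ⟨C₁, C₂, hC₁, hC₂, hD⟩ := stub_density ⟨hK, hT⟩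
  /- `L¹` norms and the choice of `A` -/
  set Q₀ : ℝ := ∫ t, |K t| with hQ₀
  set Q₁' : ℝ := ∫ t, |dK t| with hQ₁'
  set Q₂' : ℝ := ∫ t, |ddK t| with hQ₂'
  have hQ₀n : 0 ≤ Q₀ := integral_nonneg fun t => abs_nonneg _
  have hQ₁n : 0 ≤ Q₁' := integral_nonneg fun t => abs_nonneg _
  have hQ₂n : 0 ≤ Q₂' := integral_nonneg fun t => abs_nonneg _
  set Bc : ℝ := C₁ + 8 * (Q₀ + 1) ^ 2 * (C₂ + Q₀ + 2) + 1 with hBc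
  have hBc_pos : 0 < Bc := by positivity
  set A : ℝ := min (min (1 / 2) (Real.exp (-(2 * π * Bc)))) (min (1 / (Q₁' + 1)) (1 / (Q₂' + 1)))
    with hAdef
  have hA : 0 < A := by positivity
  have hA_half : A ≤ 1 / 2 := (min_le_left _ _).trans (min_le_left _ _)
  have hA1 : A ≤ 1 := hA_half.trans (by norm_num)
  have hA_exp : A ≤ Real.exp (-(2 * π * Bc)) := (min_le_left _ _).trans (min_le_right _ _)
  have hA_Q₁ : A ≤ 1 / (Q₁' + 1) := (min_le_right _ _).trans (min_le_left _ _)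
  have hA_Q₂ : A ≤ 1 / (Q₂' + 1) := (min_le_right _ _).trans (min_le_right _ _)
  have hAQ1 : A * Q₁' ≤ 1 := by
    calc A * Q₁' ≤ 1 / (Q₁' + 1) * Q₁' := mul_le_mul_of_nonneg_right hA_Q₁ hQ₁n
      _ ≤ 1 := by rw [div_mul_eq_mul_div, one_mul, div_le_one (by positivity)]; linarith
  have hAQ2 : A ^ 2 * Q₂' ≤ 1 := by
    calc A ^ 2 * Q₂' ≤ A * Q₂' := by
          refine mul_le_mul_of_nonneg_right ?_ hQ₂n; nlinarith
      _ ≤ 1 / (Q₂' + 1) * Q₂' := mul_le_mul_of_nonneg_right hA_Q₂ hQ₂n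
      _ ≤ 1 := by rw [div_mul_eq_mul_div, one_mul, div_le_one (by positivity)]; linarith
  have hlogA : 2 * π * Bc ≤ Real.log (1 / A) := by
    rw [one_div, Real.log_inv]
    have : Real.log A ≤ Real.log (Real.exp (-(2 * π * Bc))) := Real.log_le_log hA hA_exp
    rw [Real.log_exp] at this
    linarith
  have hlogA0 : 0 ≤ Real.log (1 / A) := by
    rw [one_div, Real.log_inv]; have := Real.log_nonpos hA.le hA1; linarith
  set c₀ : ℝ := Real.log (1 / A) / (2 * π) - C₁ with hc₀
  have hc₀B : 8 * (Q₀ + 1) ^ 2 * (C₂ + Q₀ + 2) + 1 ≤ c₀ := by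
    have h2π : 0 < 2 * π := by positivity
    have : Bc ≤ Real.log (1 / A) / (2 * π) := by
      rw [le_div_iff₀ h2π]; linarith
    rw [hc₀]; linarith
  /- the density at scale `A` -/
  obtain ⟨ν, dν, ddν, hν, hdν, hddνc, hνlow, hνup, hdνb, hddνb, hνW⟩ := hD A hA hA_half
  have hν_cont : Continuous ν := continuous_iff_continuousAt.2 fun t => (hν t).continuousAt
  have hdν_cont : Continuous dν := continuous_iff_continuousAt.2 fun t => (hdν t).continuousAt
  /- the kernel at scale `A` -/
  set q : ℝ → ℝ := fun t => A * K (A * t) with hqdef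
  set dq : ℝ → ℝ := fun t => A ^ 2 * dK (A * t) with hdqdef
  set ddq : ℝ → ℝ := fun t => A ^ 3 * ddK (A * t) with hddqdef
  have hlin : ∀ t : ℝ, HasDerivAt (fun x : ℝ => A * x) A t := fun t => by
    simpa using (hasDerivAt_id t).const_mul A
  have hq : ∀ t, HasDerivAt q (dq t) t := fun t => by
    have h2 : HasDerivAt (fun x : ℝ => K (A * x)) (dK (A * t) * A) t := (hKd (A * t)).comp t (hlin t)
    have h3 := h2.const_mul A
    have e : A * (dK (A * t) * A) = dq t := by simp only [hdqdef]; ring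
    rw [e] at h3
    exact h3
  have hdq : ∀ t, HasDerivAt dq (ddq t) t := fun t => by
    have h2 : HasDerivAt (fun x : ℝ => dK (A * x)) (ddK (A * t) * A) t :=
      (hdKd (A * t)).comp t (hlin t)
    have h3 := h2.const_mul (A ^ 2)
    have e : A ^ 2 * (ddK (A * t) * A) = ddq t := by simp only [hddqdef]; ring
    rw [e] at h3
    exact h3
  have hddq_cont : Continuous ddq := continuous_const.mul (hddKc.comp (continuous_const.mul continuous_id))
  have hdq_cont : Continuous dq := continuous_iff_continuousAt.2 fun t => (hdq t).continuousAt
  have hq_even : ∀ t, q (-t) = q t := fun t => by simp only [hqdef, mul_neg, hKeven]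
  have hqb : ∀ t, |q t| ≤ CK / A / (1 + t ^ 2) := fun t => by
    have h := BaseRungGlue.dilate_bound hA hA1 hCK 1 le_rfl t
    calc |q t| = A ^ 1 * |K (A * t)| := by simp only [hqdef, abs_mul, abs_of_pos hA, pow_one]
      _ ≤ A ^ 1 * (CK / (1 + (A * t) ^ 2)) := mul_le_mul_of_nonneg_left (hKb _) (by positivity)
      _ ≤ _ := h
  have hdqb : ∀ t, |dq t| ≤ CK / A / (1 + t ^ 2) := fun t => by
    have h := BaseRungGlue.dilate_bound hA hA1 hCK 2 one_le_two t
    calc |dq t| = A ^ 2 * |dK (A * t)| := by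
          simp only [hdqdef, abs_mul, abs_pow, abs_of_pos hA]
      _ ≤ A ^ 2 * (CK / (1 + (A * t) ^ 2)) := mul_le_mul_of_nonneg_left (hdKb _) (by positivity)
      _ ≤ _ := h
  have hddqb : ∀ t, |ddq t| ≤ CK / A / (1 + t ^ 2) := fun t => by
    have h := BaseRungGlue.dilate_bound hA hA1 hCK 3 (by norm_num) t
    calc |ddq t| = A ^ 3 * |ddK (A * t)| := by
          simp only [hddqdef, abs_mul, abs_pow, abs_of_pos hA]
      _ ≤ A ^ 3 * (CK / (1 + (A * t) ^ 2)) := mul_le_mul_of_nonneg_left (hddKb _) (by positivity)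
      _ ≤ _ := h
  -- `L¹` norms by change of variables `∫ F(A t) dt = A⁻¹ ∫ F`
  have hcomp : ∀ F : ℝ → ℝ, (∫ t, F (A * t)) = A⁻¹ * ∫ t, F t := fun F => by
    have h := Measure.integral_comp_mul_left F A
    rw [h, smul_eq_mul, abs_of_pos (inv_pos.2 hA)]
  have hq_L1 : (∫ t, |q t|) = Q₀ := by
    have h := hcomp fun s => |K s|
    calc (∫ t, |q t|) = ∫ t, A * |K (A * t)| := by
          congr 1 with t; simp only [hqdef, abs_mul, abs_of_pos hA]
      _ = A * ∫ t, |K (A * t)| := integral_const_mul _ _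
      _ = Q₀ := by rw [h, ← mul_assoc, mul_inv_cancel₀ hA.ne', one_mul]
  have hdq_L1 : (∫ t, |dq t|) = A * Q₁' := by
    have h := hcomp fun s => |dK s|
    calc (∫ t, |dq t|) = ∫ t, A ^ 2 * |dK (A * t)| := by
          congr 1 with t; simp only [hdqdef, abs_mul, abs_pow, abs_of_pos hA]
      _ = A ^ 2 * ∫ t, |dK (A * t)| := integral_const_mul _ _
      _ = A * Q₁' := by rw [h, ← mul_assoc, pow_two, mul_assoc A A, mul_inv_cancel₀ hA.ne', mul_one]
  have hddq_L1 : (∫ t, |ddq t|) = A ^ 2 * Q₂' := by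
    have h := hcomp fun s => |ddK s|
    calc (∫ t, |ddq t|) = ∫ t, A ^ 3 * |ddK (A * t)| := by
          congr 1 with t; simp only [hddqdef, abs_mul, abs_pow, abs_of_pos hA]
      _ = A ^ 3 * ∫ t, |ddK (A * t)| := integral_const_mul _ _
      _ = A ^ 2 * Q₂' := by
          rw [h, ← mul_assoc]
          congr 1
          field_simp
  /- reproducing identity of `q` on `[-A, A]` (the kernel of the dilated plateau IS `q`) -/
  set χA : ℝ → ℝ := fun x => χ (x / A) with hχAdef
  have hχA_smooth : ContDiff ℝ ∞ χA := hχ_smooth.comp (contDiff_id.div_const A)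
  have hχA_cpt : HasCompactSupport χA := by
    have h := hχ_cpt.comp_homeomorph (Homeomorph.mulRight₀ A⁻¹ (inv_ne_zero hA.ne'))
    convert h using 1
    funext x
    simp [hχAdef, div_eq_mul_inv]
  have hχA_even : ∀ x, χA (-x) = χA x := fun x => by simp only [hχAdef, neg_div, hχ_even]
  have hχA_one : ∀ x : ℝ, |x| ≤ A → χA x = 1 := fun x hx => by
    simp only [hχAdef]
    refine hχ_one _ ?_
    rw [abs_div, abs_of_pos hA, div_le_one hA]
    exact hx
  obtain ⟨KA, -, -, -, hKAdef, -, -, -, -, -, -, -, -, -, hKArep⟩ := hK χA hχA_smooth hχA_cpt hχA_even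
  have hKAq : KA = q := by
    funext t
    rw [hKAdef t]
    exact hKdil A hA t
  have hqrep : ∀ g : ℝ → ℂ, IsWeilTest g → tsupport g ⊆ Set.Icc (-A) A →
      ∀ t : ℝ, (∫ s, (q (t - s) : ℂ) * weilMellin g (1 / 2 + (s : ℂ) * I)) =
        weilMellin g (1 / 2 + (t : ℂ) * I) := by
    intro g hg hgs t
    have h := (hKArep g hg.1.continuous hg.2).1 t
    have hprod : (fun x => (χA x : ℂ) * g x) = g := by
      funext x
      by_cases hx : g x = 0
      · simp [hx]
      · have hxs : x ∈ tsupport g := subset_tsupport _ (Function.mem_support.2 hx)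
        have hxA : |x| ≤ A := abs_le.2 (by simpa using hgs hxs)
        rw [hχA_one x hxA]; simp
    rw [hKAq, hprod] at h
    exact h
  /- primitive of the density -/
  set M : ℝ → ℝ := fun u => ∫ s in (0 : ℝ)..u, ν s with hMdef
  have hM : ∀ u, HasDerivAt M (ν u) u := fun u => (hν_cont.integral_hasStrictDerivAt 0 u).hasDerivAt
  /- the fixed point -/
  have hsaw := stub_sawtoothSmoothing q dq Q₀ (A * Q₁') (CK / A) hq hdq_cont hqb hdqb hq_L1.le
    hdq_L1.le
  obtain ⟨f, hf_cont, hfb, hffix, hqf_d, hdqf_d, hddqf_cont, hdqf_b, hddqf_b⟩ :=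
    stub_fixedPoint q dq ddq Q₀ (A * Q₁') (A ^ 2 * Q₂') (CK / A) hq hdq hddq_cont hqb hdqb hddqb
      hq_L1.le hdq_L1.le hddq_L1.le hAQ1 hAQ2 hsaw M ν dν c₀ C₂ hM hν hdν_cont
      (fun t => by rw [hc₀]; exact hνlow t) hdνb (by linarith)
  /- the phase and its inverse -/
  obtain ⟨Φ, hΦdef⟩ : ∃ Φ : ℝ → ℝ, Φ = fun u => M u + ∫ r, q (u - r) * f r := ⟨_, rfl⟩
  obtain ⟨dΦ, hdΦdef⟩ : ∃ dΦ : ℝ → ℝ, dΦ = fun t => ν t + ∫ r, dq (t - r) * f r := ⟨_, rfl⟩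
  have hΦ_apply : ∀ u, Φ u = M u + ∫ r, q (u - r) * f r := fun u => by rw [hΦdef]
  have hdΦ_apply : ∀ t, dΦ t = ν t + ∫ r, dq (t - r) * f r := fun t => by rw [hdΦdef]
  have hΦd : ∀ t, HasDerivAt Φ (dΦ t) t := fun t => by
    rw [hΦdef, hdΦ_apply]; exact (hM t).add (hqf_d t)
  have hdqf_cont : Continuous fun t => ∫ r, dq (t - r) * f r :=
    continuous_iff_continuousAt.2 fun t => (hdqf_d t).continuousAt
  have hdΦ_cont : Continuous dΦ := by rw [hdΦdef]; exact hν_cont.add hdqf_cont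
  have hX : ∀ t, |∫ r, dq (t - r) * f r| ≤ Q₀ := fun t =>
    (hdqf_b t).trans (by
      calc A * Q₁' * Q₀ ≤ 1 * Q₀ := mul_le_mul_of_nonneg_right hAQ1 hQ₀n
        _ = Q₀ := one_mul _)
  have hQpoly : Q₀ ≤ (Q₀ + 1) ^ 2 * (C₂ + Q₀ + 2) := by
    have h1 : Q₀ ≤ (Q₀ + 1) ^ 2 := by nlinarith
    have h2 : (1 : ℝ) ≤ C₂ + Q₀ + 2 := by linarith
    calc Q₀ = Q₀ * 1 := (mul_one _).symm
      _ ≤ (Q₀ + 1) ^ 2 * (C₂ + Q₀ + 2) := mul_le_mul h1 h2 zero_le_one (by positivity)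
  have hdΦ_low : ∀ t, (1 : ℝ) ≤ dΦ t := fun t => by
    have h1 : c₀ ≤ ν t := by rw [hc₀]; exact hνlow t
    have h4 := neg_abs_le (∫ r, dq (t - r) * f r)
    have h5 := hX t
    rw [hdΦ_apply]
    linarith
  obtain ⟨D, hDdef⟩ : ∃ D : ℝ, D = Real.log (1 / A) / (2 * π) + C₁ + Q₀ := ⟨_, rfl⟩
  have hdΦ_up : ∀ t, dΦ t ≤ D * (1 + |t|) := fun t => by
    have h1 := hνup t
    have h4 := le_abs_self (∫ r, dq (t - r) * f r)
    have h5 := hX t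
    have h6 : 0 ≤ Real.log (1 / A) / (2 * π) := by positivity
    have ht1 : (1 : ℝ) ≤ 1 + |t| := by linarith [abs_nonneg t]
    have h7 : Real.log (1 / A) / (2 * π) ≤ Real.log (1 / A) / (2 * π) * (1 + |t|) :=
      le_mul_of_one_le_right h6 ht1
    have h8 : Q₀ ≤ Q₀ * (1 + |t|) := le_mul_of_one_le_right hQ₀n ht1
    have e : D * (1 + |t|) = Real.log (1 / A) / (2 * π) * (1 + |t|) + C₁ * (1 + |t|) +
        Q₀ * (1 + |t|) := by rw [hDdef]; ring
    rw [hdΦ_apply, e]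
    linarith
  have hΦ_cont : Continuous Φ := continuous_iff_continuousAt.2 fun t => (hΦd t).continuousAt
  have hΦ_diff : Differentiable ℝ Φ := fun t => (hΦd t).differentiableAt
  have hΦ_deriv : ∀ t, (1 : ℝ) ≤ deriv Φ t := fun t => by rw [(hΦd t).deriv]; exact hdΦ_low t
  have hΦ_growth : ∀ x y : ℝ, x ≤ y → 1 * (y - x) ≤ Φ y - Φ x := fun x y hxy =>
    mul_sub_le_image_sub_of_le_deriv hΦ_diff hΦ_deriv hxy
  have htop : Filter.Tendsto Φ Filter.atTop Filter.atTop := by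
    refine Filter.tendsto_atTop_mono' Filter.atTop ?_
      (Filter.tendsto_atTop_add_const_right _ (Φ 0) Filter.tendsto_id)
    filter_upwards [Filter.eventually_ge_atTop (0 : ℝ)] with y hy
    have := hΦ_growth 0 y hy
    simp only [id]; linarith
  have hbot : Filter.Tendsto Φ Filter.atBot Filter.atBot := by
    refine Filter.tendsto_atBot_mono' Filter.atBot ?_
      (Filter.tendsto_atBot_add_const_right _ (Φ 0) Filter.tendsto_id)
    filter_upwards [Filter.eventually_le_atBot (0 : ℝ)] with y hy
    have := hΦ_growth y 0 hy
    simp only [id]; linarith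
  have hsurj : Function.Surjective Φ := hΦ_cont.surjective htop hbot
  obtain ⟨Ψ, hΨdef⟩ : ∃ Ψ : ℝ → ℝ, Ψ = Function.surjInv hsurj := ⟨_, rfl⟩
  have hΨ : ∀ y, Φ (Ψ y) = y := fun y => by rw [hΨdef]; exact Function.surjInv_eq hsurj y
  /- the warped Euler–Maclaurin identity for every Weil test -/
  have hSBP : ∀ g : ℝ → ℂ, IsWeilTest g →
      HasSum (fun n : ℤ => weilMellin g (1 / 2 + ((Ψ n : ℝ) : ℂ) * I))
        ((∫ t : ℝ, weilMellin g (1 / 2 + (t : ℂ) * I) * (dΦ t : ℂ)) +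
          ∫ t : ℝ, weilMellin (fun x : ℝ => I * (x : ℂ) * g x) (1 / 2 + (t : ℂ) * I) *
            ((Int.fract (Φ t) : ℝ) : ℂ)) := by
    intro g hg
    obtain ⟨hFd, hxg, -, Cg, hCg⟩ := hT g hg
    obtain ⟨hdFd, -, -, Cg', hCg'⟩ := hT _ hxg
    have hdF_cont : Continuous fun t : ℝ =>
        weilMellin (fun x : ℝ => I * (x : ℂ) * g x) (1 / 2 + (t : ℂ) * I) :=
      continuous_iff_continuousAt.2 fun t => (hdFd t).continuousAt
    have hb1 : ∀ t : ℝ, ‖weilMellin g (1 / 2 + (t : ℂ) * I)‖ ≤ max Cg Cg' / (1 + t ^ 2) ^ 2 :=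
      fun t => (hCg t).trans (div_le_div_of_nonneg_right (le_max_left _ _) (by positivity))
    have hb2 : ∀ t : ℝ, ‖weilMellin (fun x : ℝ => I * (x : ℂ) * g x) (1 / 2 + (t : ℂ) * I)‖ ≤
        max Cg Cg' / (1 + t ^ 2) ^ 2 :=
      fun t => (hCg' t).trans (div_le_div_of_nonneg_right (le_max_right _ _) (by positivity))
    exact stub_sumByParts Φ dΦ Ψ 1 D one_pos hΦd hdΦ_cont hdΦ_low hdΦ_up hΨ
      (fun s : ℝ => weilMellin g (1 / 2 + (s : ℂ) * I))
      (fun t : ℝ => weilMellin (fun x : ℝ => I * (x : ℂ) * g x) (1 / 2 + (t : ℂ) * I))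
      (max Cg Cg') hFd hdF_cont hb1 hb2
  /- assembly -/
  refine ⟨A, hA, ℤ, fun n => Ψ n, fun g hg hgs => ?_⟩
  have hffix' : ∀ u, f u = ∫ s, q (u - s) * Int.fract (Φ s) := fun u => by
    rw [hΦdef]; exact hffix u
  exact stub_verify A q dq ν f Φ dΦ Ψ (CK / A) Q₀ hA hq hdq_cont hq_even hqb hdqb hqrep hν_cont hνW
    hf_cont hfb hffix' hΦd hdΦ_apply hdqf_cont hSBP hT g hg hgs

/-! ### Consequences for the line: the crux is exactly OPEN, and OPEN ↔ RH, unconditionally -/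

/-- **`X ↔ OPEN`.** With the base rung proved (`stub_baseRung`) and closedness landed
(`stub_closedLadder`), the crux `SpectralThesis` is EQUIVALENT to the openness of the set of
windows carrying a rung (every rung extends a little). [folklore] -/
theorem spectralThesis_iff_openLadder :
    SpectralThesis ↔
      (∀ A : ℝ, 0 < A →
        (∃ (ι : Type) (γ : ι → ℝ), ∀ g : ℝ → ℂ, IsWeilTest g → tsupport g ⊆ Set.Ioo (-A) A →
          HasSum (fun i => weilMellin g (1 / 2 + (γ i : ℂ) * I)) (weilFunctional g)) →
        ∃ ε : ℝ, 0 < ε ∧ ∃ (ι : Type) (γ : ι → ℝ), ∀ g : ℝ → ℂ, IsWeilTest g →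
          tsupport g ⊆ Set.Ioo (-(A + ε)) (A + ε) →
            HasSum (fun i => weilMellin g (1 / 2 + (γ i : ℂ) * I)) (weilFunctional g)) :=
  ⟨fun h => (spectralThesis_iff_base_and_open.1 h).2,
    fun hO => spectralThesis_of_base_of_open stub_baseRung hO⟩

/-- **OPEN ↔ RH**, with no seed hypothesis (the base being a theorem): the registered openness stub
`stub_openLadder` of the line carries exactly the Riemann hypothesis. [folklore] -/
theorem openLadder_iff_riemannHypothesis :
    (∀ A : ℝ, 0 < A →
        (∃ (ι : Type) (γ : ι → ℝ), ∀ g : ℝ → ℂ, IsWeilTest g → tsupport g ⊆ Set.Ioo (-A) A →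
          HasSum (fun i => weilMellin g (1 / 2 + (γ i : ℂ) * I)) (weilFunctional g)) →
        ∃ ε : ℝ, 0 < ε ∧ ∃ (ι : Type) (γ : ι → ℝ), ∀ g : ℝ → ℂ, IsWeilTest g →
          tsupport g ⊆ Set.Ioo (-(A + ε)) (A + ε) →
            HasSum (fun i => weilMellin g (1 / 2 + (γ i : ℂ) * I)) (weilFunctional g)) ↔
      _root_.RiemannHypothesis :=
  ⟨fun hO => riemannHypothesis_of_base_of_open stub_baseRung hO, open_of_riemannHypothesis⟩

end Summit.RiemannHypothesis.RiemannHypothesis.Theorems.SpectralThesis.Sketch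

end
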